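import Summits.NavierStokesRegularity.NavierStokesRegularity.Theorems.PerpetualPumpThesisTameDuhamelBoundPieces
import Summits.NavierStokesRegularity.NavierStokesRegularity.Theorems.PerpetualPumpThesisBilinearOperatorSpace

/-!
# Stub `tameDuhamelBound` for `PerpetualPump.Thesis`, part IV: the three frequency regions

Support file (part 4 of the stub `tameDuhamelBound` of line `SketchIdeator2`, crux
stmt-NavierStokesRegularity-1832). Bony's bookkeeping for the pieces `⟨B(P_jF, P_kG), H⟩` of
Tao's Euler form (J. Amer. Math. Soc. 29 (2016), (1.3)): the output frequency `ξ₃ = -ξ₁-ξ₂` of a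
pair of dyadic pieces lies in the annulus `2^{k-2} ≤ |ξ₃| ≤ 2^{k+2}` when `k ≥ j + 3` and in the
ball `|ξ₃| ≤ 2^{j+4}` when `|j - k| ≤ 2` (BCD §2.6.1), so the master bound of part III applies with
an annular, resp. a low-frequency, cutoff on `H`; the Sobolev weights are then transferred between
comparable frequencies (`FB.weight_ann_le`, `FB.weight_ball_le`: `|η|²⟨η⟩^{18} ≤ 4^{10(n+1)}⟨ξ⟩^{20}`
for `|ξ| > 2^{k-1}`, `|η| < 2^{k+n}`):

* `FB.enorm_eulerForm_pieces_le_hi` (`k ≥ j+3`):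
  `|⟨B(P_jF,P_kG),H⟩| ≤ 72π·2⁴⁰ ‖Δ̇_jF‖_∞ ‖1_{ann_k}⟨ξ⟩^{10}Ĝ‖₂ ‖1_{A_k}⟨ξ⟩^{-9}Ĥ‖₂`;
* `FB.enorm_eulerForm_pieces_le_diag` (`|j-k| ≤ 2`):
  `|⟨B(P_jF,P_kG),H⟩| ≤ 72π·2⁸⁰ ‖Δ̇_jF‖_∞ ‖G‖_{H¹⁰} ‖H‖_{H⁻⁹}`.

## References

* H. Bahouri, J.-Y. Chemin, R. Danchin, *Fourier Analysis and Nonlinear PDE* (2011), §2.6.1.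
* T. Tao, J. Amer. Math. Soc. 29 (2016), 601–674, §1.1 (1.3).
-/

noncomputable section

open MeasureTheory Filter Topology FourierTransform Real Complex
open scoped SchwartzMap ENNReal NNReal FourierTransform

set_option linter.dupNamespace false

namespace Summit.NavierStokesRegularity.NavierStokesRegularity.Theorems.PerpetualPumpThesis.FB

open Literature.Analysis.FunctionSpaces Literature.Analysis.FluidPDE
  Literature.Analysis.FluidPDE.Tao2016

/-! ### Weight transfer between comparable frequencies -/

/-- On the annulus `|ξ| > 2^{k-1}`: `(1 + (2^{k-1})²)^{10} ≤ (1+|ξ|²)^{10}`. -/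
theorem weight_ann_le {k : ℤ} {ξ : EuclideanSpace ℝ (Fin 3)} (hξ : (2 : ℝ) ^ (k - 1) < ‖ξ‖) :
    (1 + ((2 : ℝ) ^ (k - 1)) ^ 2) ^ 10 ≤ (1 + ‖ξ‖ ^ 2) ^ 10 := by
  have h0 : (0 : ℝ) ≤ (2 : ℝ) ^ (k - 1) := zpow_nonneg zero_le_two _
  gcongr

/-- `2^{k+n} = 2^{n+1} · 2^{k-1}`. -/
theorem two_zpow_add_eq (k : ℤ) (n : ℕ) : (2 : ℝ) ^ (k + n) = (2 : ℝ) ^ (n + 1) * (2 : ℝ) ^ (k - 1) := by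
  rw [show k + (n : ℤ) = ((n + 1 : ℕ) : ℤ) + (k - 1) by push_cast; ring, zpow_add₀ two_ne_zero,
    zpow_natCast]

/-- In the ball `|η| < 2^{k+n}`: `|η|² (1+|η|²)⁹ ≤ 4^{10(n+1)} (1 + (2^{k-1})²)^{10}`. -/
theorem weight_ball_le {k : ℤ} {n : ℕ} {η : EuclideanSpace ℝ (Fin 3)} (hη : ‖η‖ < (2 : ℝ) ^ (k + n)) :
    ‖η‖ ^ 2 * (1 + ‖η‖ ^ 2) ^ 9 ≤ (4 : ℝ) ^ (10 * (n + 1)) * (1 + ((2 : ℝ) ^ (k - 1)) ^ 2) ^ 10 := by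
  set c : ℝ := (2 : ℝ) ^ (k - 1) with hc
  have hc0 : 0 ≤ c := zpow_nonneg zero_le_two _
  have hm1 : (1 : ℝ) ≤ (4 : ℝ) ^ (n + 1) := one_le_pow₀ (by norm_num)
  have hη2 : ‖η‖ ^ 2 ≤ (4 : ℝ) ^ (n + 1) * c ^ 2 := by
    have h1 : ‖η‖ ≤ (2 : ℝ) ^ (n + 1) * c := by rw [hc, ← two_zpow_add_eq]; exact hη.le
    calc ‖η‖ ^ 2 ≤ ((2 : ℝ) ^ (n + 1) * c) ^ 2 := pow_le_pow_left₀ (norm_nonneg _) h1 2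
      _ = (4 : ℝ) ^ (n + 1) * c ^ 2 := by rw [mul_pow, ← pow_mul, pow_mul']; norm_num
  have hone : 1 + ‖η‖ ^ 2 ≤ (4 : ℝ) ^ (n + 1) * (1 + c ^ 2) := by nlinarith [sq_nonneg c]
  calc ‖η‖ ^ 2 * (1 + ‖η‖ ^ 2) ^ 9 ≤ (1 + ‖η‖ ^ 2) * (1 + ‖η‖ ^ 2) ^ 9 := by
        gcongr; linarith [sq_nonneg ‖η‖]
    _ = (1 + ‖η‖ ^ 2) ^ 10 := by ring
    _ ≤ ((4 : ℝ) ^ (n + 1) * (1 + c ^ 2)) ^ 10 := pow_le_pow_left₀ (by positivity) hone 10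
    _ = (4 : ℝ) ^ (10 * (n + 1)) * (1 + c ^ 2) ^ 10 := by rw [mul_pow, ← pow_mul, mul_comm (n + 1)]

/-- **Weight transfer**: for `S ⊆ {|η| < 2^{k+n}}`,
`(∫_{ann_k} |Ĝ|²)(∫_S |η|²|Ĥ|²) ≤ 4^{10(n+1)} (∫_{ann_k} (1+|ξ|²)^{10}|Ĝ|²)(∫_S (1+|η|²)^{-9}|Ĥ|²)`,
`ann_k = {2^{k-1} < |ξ| < 2^{k+1}}`. -/
theorem localized_product_le (G H : L2C) (k : ℤ) (n : ℕ) {S : Set (EuclideanSpace ℝ (Fin 3))}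
    (hS : MeasurableSet S) (hSb : ∀ η ∈ S, ‖η‖ < (2 : ℝ) ^ (k + n)) :
    (∫⁻ ξ in {ξ : EuclideanSpace ℝ (Fin 3) | (2 : ℝ) ^ (k - 1) < ‖ξ‖ ∧ ‖ξ‖ < (2 : ℝ) ^ (k + 1)},
        ‖fourierFn G ξ‖ₑ ^ 2) * (∫⁻ η in S, ‖η‖ₑ ^ 2 * ‖fourierFn H η‖ₑ ^ 2) ≤
      (4 : ℝ≥0∞) ^ (10 * (n + 1)) *
        (∫⁻ ξ in {ξ : EuclideanSpace ℝ (Fin 3) | (2 : ℝ) ^ (k - 1) < ‖ξ‖ ∧ ‖ξ‖ < (2 : ℝ) ^ (k + 1)},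
          ENNReal.ofReal ((1 + ‖ξ‖ ^ 2) ^ (10 : ℝ)) * ‖fourierFn G ξ‖ₑ ^ 2) *
        (∫⁻ η in S, ENNReal.ofReal ((1 + ‖η‖ ^ 2) ^ (-9 : ℝ)) * ‖fourierFn H η‖ₑ ^ 2) := by
  set a : ℝ := (1 + ((2 : ℝ) ^ (k - 1)) ^ 2) ^ 10 with ha
  have ha0 : 0 < a := by positivity
  -- (i) the annulus
  have h1 : ENNReal.ofReal a * ∫⁻ ξ in {ξ : EuclideanSpace ℝ (Fin 3) |
      (2 : ℝ) ^ (k - 1) < ‖ξ‖ ∧ ‖ξ‖ < (2 : ℝ) ^ (k + 1)}, ‖fourierFn G ξ‖ₑ ^ 2 ≤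
      ∫⁻ ξ in {ξ : EuclideanSpace ℝ (Fin 3) | (2 : ℝ) ^ (k - 1) < ‖ξ‖ ∧ ‖ξ‖ < (2 : ℝ) ^ (k + 1)},
        ENNReal.ofReal ((1 + ‖ξ‖ ^ 2) ^ (10 : ℝ)) * ‖fourierFn G ξ‖ₑ ^ 2 := by
    rw [← lintegral_const_mul' _ _ ENNReal.ofReal_ne_top]
    refine setLIntegral_mono' (measurableSet_annulus _ _) fun ξ hξ => mul_le_mul' ?_ le_rfl
    refine ENNReal.ofReal_le_ofReal ?_
    rw [show (10 : ℝ) = ((10 : ℕ) : ℝ) by norm_num, Real.rpow_natCast]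
    exact weight_ann_le hξ.1
  -- (ii) the set `S`
  have h2 : ∫⁻ η in S, ‖η‖ₑ ^ 2 * ‖fourierFn H η‖ₑ ^ 2 ≤
      ENNReal.ofReal ((4 : ℝ) ^ (10 * (n + 1)) * a) *
        ∫⁻ η in S, ENNReal.ofReal ((1 + ‖η‖ ^ 2) ^ (-9 : ℝ)) * ‖fourierFn H η‖ₑ ^ 2 := by
    rw [← lintegral_const_mul' _ _ ENNReal.ofReal_ne_top]
    refine setLIntegral_mono' hS fun η hη => ?_
    rw [← mul_assoc]
    refine mul_le_mul' ?_ le_rfl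
    have hpos : (0 : ℝ) < 1 + ‖η‖ ^ 2 := by positivity
    rw [← ofReal_norm, ← ENNReal.ofReal_pow (norm_nonneg _), ← ENNReal.ofReal_mul (by positivity)]
    refine ENNReal.ofReal_le_ofReal ?_
    rw [Real.rpow_neg hpos.le, show (9 : ℝ) = ((9 : ℕ) : ℝ) by norm_num, Real.rpow_natCast,
      ← div_eq_mul_inv, le_div_iff₀ (pow_pos hpos 9)]
    exact weight_ball_le (hSb η hη)
  -- (iii) combine
  have h4 : ENNReal.ofReal ((4 : ℝ) ^ (10 * (n + 1)) * a) = (4 : ℝ≥0∞) ^ (10 * (n + 1)) * ENNReal.ofReal a := by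
    rw [ENNReal.ofReal_mul (by positivity), ENNReal.ofReal_pow (by norm_num), ENNReal.ofReal_ofNat]
  calc (∫⁻ ξ in {ξ : EuclideanSpace ℝ (Fin 3) | (2 : ℝ) ^ (k - 1) < ‖ξ‖ ∧ ‖ξ‖ < (2 : ℝ) ^ (k + 1)},
        ‖fourierFn G ξ‖ₑ ^ 2) * (∫⁻ η in S, ‖η‖ₑ ^ 2 * ‖fourierFn H η‖ₑ ^ 2)
      ≤ (∫⁻ ξ in {ξ : EuclideanSpace ℝ (Fin 3) | (2 : ℝ) ^ (k - 1) < ‖ξ‖ ∧ ‖ξ‖ < (2 : ℝ) ^ (k + 1)},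
        ‖fourierFn G ξ‖ₑ ^ 2) * (ENNReal.ofReal ((4 : ℝ) ^ (10 * (n + 1)) * a) *
        ∫⁻ η in S, ENNReal.ofReal ((1 + ‖η‖ ^ 2) ^ (-9 : ℝ)) * ‖fourierFn H η‖ₑ ^ 2) :=
        mul_le_mul' le_rfl h2
    _ = (4 : ℝ≥0∞) ^ (10 * (n + 1)) * (ENNReal.ofReal a *
        ∫⁻ ξ in {ξ : EuclideanSpace ℝ (Fin 3) | (2 : ℝ) ^ (k - 1) < ‖ξ‖ ∧ ‖ξ‖ < (2 : ℝ) ^ (k + 1)},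
          ‖fourierFn G ξ‖ₑ ^ 2) *
        ∫⁻ η in S, ENNReal.ofReal ((1 + ‖η‖ ^ 2) ^ (-9 : ℝ)) * ‖fourierFn H η‖ₑ ^ 2 := by
        rw [h4]; ring
    _ ≤ _ := by gcongr

/-- **Weight transfer, square-root form**: for `S ⊆ {|η| < 2^{k+n}}`,
`‖1_{ann_k}Ĝ‖₂ ‖1_S |η| Ĥ‖₂ ≤ 2^{10(n+1)} ‖1_{ann_k}⟨ξ⟩^{10}Ĝ‖₂ ‖1_S ⟨η⟩^{-9}Ĥ‖₂`. -/
theorem localized_product_rpow_le (G H : L2C) (k : ℤ) (n : ℕ) {S : Set (EuclideanSpace ℝ (Fin 3))}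
    (hS : MeasurableSet S) (hSb : ∀ η ∈ S, ‖η‖ < (2 : ℝ) ^ (k + n)) :
    (∫⁻ ξ in {ξ : EuclideanSpace ℝ (Fin 3) | (2 : ℝ) ^ (k - 1) < ‖ξ‖ ∧ ‖ξ‖ < (2 : ℝ) ^ (k + 1)},
        ‖fourierFn G ξ‖ₑ ^ 2) ^ (1 / 2 : ℝ) *
      (∫⁻ η in S, ‖η‖ₑ ^ 2 * ‖fourierFn H η‖ₑ ^ 2) ^ (1 / 2 : ℝ) ≤
      (2 : ℝ≥0∞) ^ (10 * (n + 1)) *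
        (∫⁻ ξ in {ξ : EuclideanSpace ℝ (Fin 3) | (2 : ℝ) ^ (k - 1) < ‖ξ‖ ∧ ‖ξ‖ < (2 : ℝ) ^ (k + 1)},
          ENNReal.ofReal ((1 + ‖ξ‖ ^ 2) ^ (10 : ℝ)) * ‖fourierFn G ξ‖ₑ ^ 2) ^ (1 / 2 : ℝ) *
        (∫⁻ η in S, ENNReal.ofReal ((1 + ‖η‖ ^ 2) ^ (-9 : ℝ)) * ‖fourierFn H η‖ₑ ^ 2) ^ (1 / 2 : ℝ) := by
  have h := ENNReal.rpow_le_rpow (localized_product_le G H k n hS hSb) (by norm_num : (0 : ℝ) ≤ 1 / 2)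
  rw [ENNReal.mul_rpow_of_nonneg _ _ (by norm_num), ENNReal.mul_rpow_of_nonneg _ _ (by norm_num),
    ENNReal.mul_rpow_of_nonneg _ _ (by norm_num)] at h
  have h4 : ((4 : ℝ≥0∞) ^ (10 * (n + 1))) ^ (1 / 2 : ℝ) = (2 : ℝ≥0∞) ^ (10 * (n + 1)) := by
    rw [show (4 : ℝ≥0∞) = 2 ^ 2 by norm_num, ← pow_mul, ← ENNReal.rpow_natCast, ← ENNReal.rpow_mul,
      ← ENNReal.rpow_natCast]
    congr 1
    push_cast
    ring
  rwa [h4] at h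

/-! ### The cutoffs -/

/-- `χ(2^{-m} η) = 0` for `|η| ≥ 2^{m+1}`. -/
theorem lowFreqSymbol_eq_zero_of_le_norm {m : ℤ} {η : EuclideanSpace ℝ (Fin 3)}
    (h : (2 : ℝ) ^ (m + 1) ≤ ‖η‖) : lowFreqSymbol m η = 0 := by
  simp only [lowFreqSymbol]
  rw [dyadicCutoff_apply_of_two_le_norm, Complex.ofReal_zero]
  rw [norm_two_zpow_smul]
  have h2 : (0 : ℝ) < (2 : ℝ) ^ (-m) := zpow_pos two_pos _
  calc (2 : ℝ) = (2 : ℝ) ^ (-m) * (2 : ℝ) ^ (m + 1) := by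
        rw [← zpow_add₀ two_ne_zero]; norm_num
    _ ≤ (2 : ℝ) ^ (-m) * ‖η‖ := mul_le_mul_of_nonneg_left h h2.le

/-- The low-frequency symbols are continuous and bounded, hence `L^∞` symbols. -/
theorem memLp_top_lowFreqSymbol (m : ℤ) :
    MemLp (lowFreqSymbol (E := EuclideanSpace ℝ (Fin 3)) m) ∞ (volume : Measure (EuclideanSpace ℝ (Fin 3))) :=
  memLp_top_of_bound (contDiff_lowFreqSymbol m).continuous.aestronglyMeasurable 1
    (ae_of_all _ (norm_lowFreqSymbol_le_one m))

/-- The annular cutoff `χ(2^{-(k+2)}·) - χ(2^{-(k-3)}·)` is an `L^∞` symbol. -/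
theorem memLp_top_annularCutoff (k : ℤ) :
    MemLp (fun η : EuclideanSpace ℝ (Fin 3) => lowFreqSymbol (k + 2) η - lowFreqSymbol (k - 3) η) ∞
      (volume : Measure (EuclideanSpace ℝ (Fin 3))) :=
  (memLp_top_lowFreqSymbol (k + 2)).sub (memLp_top_lowFreqSymbol (k - 3))

/-- `2^a + 2^a = 2^{a+1}`. -/
theorem two_zpow_add_self (a : ℤ) : (2 : ℝ) ^ a + (2 : ℝ) ^ a = (2 : ℝ) ^ (a + 1) := by
  rw [← two_mul, ← zpow_one_add₀ two_ne_zero, add_comm]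

/-- **The high region**: for `k ≥ j+3`, `ξ₁ ∈ ann_j`, `ξ₂ ∈ ann_k`, the output frequency satisfies
`2^{k-2} ≤ |ξ₁+ξ₂| ≤ 2^{k+2}`, where the annular cutoff equals `1`. -/
theorem annularCutoff_eq_one {j k : ℤ} (hjk : j + 3 ≤ k) {ξ₁ ξ₂ : EuclideanSpace ℝ (Fin 3)}
    (h₁ : ξ₁ ∈ {ξ : EuclideanSpace ℝ (Fin 3) | (2 : ℝ) ^ (j - 1) < ‖ξ‖ ∧ ‖ξ‖ < (2 : ℝ) ^ (j + 1)})
    (h₂ : ξ₂ ∈ {ξ : EuclideanSpace ℝ (Fin 3) | (2 : ℝ) ^ (k - 1) < ‖ξ‖ ∧ ‖ξ‖ < (2 : ℝ) ^ (k + 1)}) :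
    lowFreqSymbol (k + 2) (-ξ₁ - ξ₂) - lowFreqSymbol (k - 3) (-ξ₁ - ξ₂) = 1 := by
  have hnorm : ‖-ξ₁ - ξ₂‖ = ‖ξ₁ + ξ₂‖ := by rw [← norm_neg, neg_sub, sub_neg_eq_add, add_comm]
  have hj1 : (2 : ℝ) ^ (j + 1) ≤ (2 : ℝ) ^ (k - 2) := zpow_le_zpow_right₀ one_le_two (by omega)
  have hup : ‖ξ₁ + ξ₂‖ ≤ (2 : ℝ) ^ (k + 2) := by
    have hk1 : (2 : ℝ) ^ (k - 2) ≤ (2 : ℝ) ^ (k + 1) := zpow_le_zpow_right₀ one_le_two (by omega)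
    calc ‖ξ₁ + ξ₂‖ ≤ ‖ξ₁‖ + ‖ξ₂‖ := norm_add_le _ _
      _ ≤ (2 : ℝ) ^ (k + 1) + (2 : ℝ) ^ (k + 1) := by linarith [h₁.2, h₂.2]
      _ = (2 : ℝ) ^ (k + 2) := by rw [two_zpow_add_self]; ring_nf
  have hlow : (2 : ℝ) ^ (k - 3 + 1) ≤ ‖ξ₁ + ξ₂‖ := by
    have hsub : ‖ξ₂‖ - ‖ξ₁‖ ≤ ‖ξ₁ + ξ₂‖ := by
      have := norm_sub_norm_le ξ₂ (-ξ₁)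
      rw [norm_neg, sub_neg_eq_add, add_comm] at this
      exact this
    have hhalf : (2 : ℝ) ^ (k - 2) + (2 : ℝ) ^ (k - 2) = (2 : ℝ) ^ (k - 1) := by
      rw [two_zpow_add_self]; ring_nf
    rw [show k - 3 + 1 = k - 2 by ring]
    linarith [h₁.2, h₂.1]
  have hup' : ‖-ξ₁ - ξ₂‖ ≤ (2 : ℝ) ^ (k + 2) := by rw [hnorm]; exact hup
  have hlow' : (2 : ℝ) ^ (k - 3 + 1) ≤ ‖-ξ₁ - ξ₂‖ := by rw [hnorm]; exact hlow
  rw [lowFreqSymbol_eq_one_of_norm_le hup', lowFreqSymbol_eq_zero_of_le_norm hlow', sub_zero]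

/-- The annular cutoff vanishes off `A_k = {2^{k-3} < |η| < 2^{k+3}}`. -/
theorem annularCutoff_eq_zero {k : ℤ} {η : EuclideanSpace ℝ (Fin 3)}
    (hη : η ∉ {ξ : EuclideanSpace ℝ (Fin 3) | (2 : ℝ) ^ (k - 3) < ‖ξ‖ ∧ ‖ξ‖ < (2 : ℝ) ^ (k + 3)}) :
    lowFreqSymbol (k + 2) η - lowFreqSymbol (k - 3) η = 0 := by
  rcases not_and_or.1 hη with h | h
  · rw [not_lt] at h
    have h' : ‖η‖ ≤ (2 : ℝ) ^ (k + 2) := h.trans (zpow_le_zpow_right₀ one_le_two (by omega))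
    rw [lowFreqSymbol_eq_one_of_norm_le h', lowFreqSymbol_eq_one_of_norm_le h, sub_self]
  · rw [not_lt] at h
    have h' : (2 : ℝ) ^ (k - 3 + 1) ≤ ‖η‖ := (zpow_le_zpow_right₀ one_le_two (by omega)).trans h
    have h'' : (2 : ℝ) ^ (k + 2 + 1) ≤ ‖η‖ := by rw [show k + 2 + 1 = k + 3 by ring]; exact h
    rw [lowFreqSymbol_eq_zero_of_le_norm h'', lowFreqSymbol_eq_zero_of_le_norm h', sub_self]

/-- The annular cutoff is bounded by `2`. -/
theorem norm_annularCutoff_le (k : ℤ) (η : EuclideanSpace ℝ (Fin 3)) :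
    ‖lowFreqSymbol (k + 2) η - lowFreqSymbol (k - 3) η‖ ≤ 2 := by
  have h1 : ‖lowFreqSymbol (E := EuclideanSpace ℝ (Fin 3)) (k + 2) η‖ ≤ 1 := norm_lowFreqSymbol_le_one _ η
  have h2 : ‖lowFreqSymbol (E := EuclideanSpace ℝ (Fin 3)) (k - 3) η‖ ≤ 1 := norm_lowFreqSymbol_le_one _ η
  exact (norm_sub_le _ _).trans (by linarith)

/-- **The diagonal region**: for `|j-k| ≤ 2`, `ξ₁ ∈ ann_j`, `ξ₂ ∈ ann_k`, the output frequency has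
`|ξ₁+ξ₂| ≤ 2^{j+4}`, where the low-frequency cutoff `χ(2^{-(j+4)}·)` equals `1`. -/
theorem lowCutoff_eq_one {j k : ℤ} (hkj : k ≤ j + 2) {ξ₁ ξ₂ : EuclideanSpace ℝ (Fin 3)}
    (h₁ : ξ₁ ∈ {ξ : EuclideanSpace ℝ (Fin 3) | (2 : ℝ) ^ (j - 1) < ‖ξ‖ ∧ ‖ξ‖ < (2 : ℝ) ^ (j + 1)})
    (h₂ : ξ₂ ∈ {ξ : EuclideanSpace ℝ (Fin 3) | (2 : ℝ) ^ (k - 1) < ‖ξ‖ ∧ ‖ξ‖ < (2 : ℝ) ^ (k + 1)}) :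
    lowFreqSymbol (j + 4) (-ξ₁ - ξ₂) = 1 := by
  have hnorm : ‖-ξ₁ - ξ₂‖ = ‖ξ₁ + ξ₂‖ := by rw [← norm_neg, neg_sub, sub_neg_eq_add, add_comm]
  have hk : (2 : ℝ) ^ (k + 1) ≤ (2 : ℝ) ^ (j + 3) := zpow_le_zpow_right₀ one_le_two (by omega)
  have hj : (2 : ℝ) ^ (j + 1) ≤ (2 : ℝ) ^ (j + 3) := zpow_le_zpow_right₀ one_le_two (by omega)
  have hup : ‖ξ₁ + ξ₂‖ ≤ (2 : ℝ) ^ (j + 4) := by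
    calc ‖ξ₁ + ξ₂‖ ≤ ‖ξ₁‖ + ‖ξ₂‖ := norm_add_le _ _
      _ ≤ (2 : ℝ) ^ (j + 3) + (2 : ℝ) ^ (j + 3) := by linarith [h₁.2, h₂.2]
      _ = (2 : ℝ) ^ (j + 4) := by rw [two_zpow_add_self]; ring_nf
  have hup' : ‖-ξ₁ - ξ₂‖ ≤ (2 : ℝ) ^ (j + 4) := by rw [hnorm]; exact hup
  rw [lowFreqSymbol_eq_one_of_norm_le hup']

/-- A frequency-localized energy over a bounded set is finite: `∫_S |η|²|Ĥ|² ≤ R² ‖H‖²`. -/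
theorem setLIntegral_sq_lt_top (H : L2C) {S : Set (EuclideanSpace ℝ (Fin 3))} {R : ℝ}
    (hSb : ∀ η ∈ S, ‖η‖ < R) (hS : MeasurableSet S) :
    ∫⁻ η in S, ‖η‖ₑ ^ 2 * ‖fourierFn H η‖ₑ ^ 2 < ⊤ := by
  have hR : ∀ η ∈ S, ‖η‖ₑ ^ 2 ≤ ENNReal.ofReal (R ^ 2) := fun η hη => by
    rw [← ofReal_norm, ← ENNReal.ofReal_pow (norm_nonneg _)]
    exact ENNReal.ofReal_le_ofReal (pow_le_pow_left₀ (norm_nonneg _) (hSb η hη).le 2)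
  calc ∫⁻ η in S, ‖η‖ₑ ^ 2 * ‖fourierFn H η‖ₑ ^ 2
      ≤ ∫⁻ η in S, ENNReal.ofReal (R ^ 2) * ‖fourierFn H η‖ₑ ^ 2 :=
        setLIntegral_mono' hS fun η hη => mul_le_mul' (hR η hη) le_rfl
    _ ≤ ∫⁻ η, ENNReal.ofReal (R ^ 2) * ‖fourierFn H η‖ₑ ^ 2 := setLIntegral_le_lintegral _ _
    _ = ENNReal.ofReal (R ^ 2) * ‖H‖ₑ ^ 2 := by
        rw [lintegral_const_mul' _ _ ENNReal.ofReal_ne_top, B.lintegral_enorm_sq_fourierFn]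
    _ < ⊤ := ENNReal.mul_lt_top ENNReal.ofReal_lt_top (ENNReal.pow_lt_top enorm_lt_top)

/-! ### The region bounds -/

/-- **The high region `k ≥ j + 3`**:
`|⟨B(P_jF, P_kG), H⟩| ≤ 72π · 2⁴⁰ ‖Δ̇_jF‖_{L^∞} ‖1_{ann_k}⟨ξ⟩^{10}Ĝ‖_{L²} ‖1_{A_k}⟨η⟩^{-9}Ĥ‖_{L²}`,
`A_k = {2^{k-3} < |η| < 2^{k+3}}`. -/
theorem enorm_eulerForm_pieces_le_hi {F G : L2C} (H : L2C) (hF : IsFourierDivFree F)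
    (hG : IsFourierDivFree G) {j k : ℤ} (hjk : j + 3 ≤ k) :
    ‖eulerForm (fourierMultiplier ((memLp_top_dyadicSymbol (E := EuclideanSpace ℝ (Fin 3)) j).toLp _) F)
        (fourierMultiplier ((memLp_top_dyadicSymbol (E := EuclideanSpace ℝ (Fin 3)) k).toLp _) G) H‖ₑ ≤
      ENNReal.ofReal (72 * π) * 2 ^ 40 *
        eLpNormDistrib ∞ (lpBlock j ((F : L2C) : 𝓢'(EuclideanSpace ℝ (Fin 3), EuclideanSpace ℂ (Fin 3)))) *
        (∫⁻ ξ in {ξ : EuclideanSpace ℝ (Fin 3) | (2 : ℝ) ^ (k - 1) < ‖ξ‖ ∧ ‖ξ‖ < (2 : ℝ) ^ (k + 1)},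
          ENNReal.ofReal ((1 + ‖ξ‖ ^ 2) ^ (10 : ℝ)) * ‖fourierFn G ξ‖ₑ ^ 2) ^ (1 / 2 : ℝ) *
        (∫⁻ η in {ξ : EuclideanSpace ℝ (Fin 3) | (2 : ℝ) ^ (k - 3) < ‖ξ‖ ∧ ‖ξ‖ < (2 : ℝ) ^ (k + 3)},
          ENNReal.ofReal ((1 + ‖η‖ ^ 2) ^ (-9 : ℝ)) * ‖fourierFn H η‖ₑ ^ 2) ^ (1 / 2 : ℝ) := by
  have hS : MeasurableSet {ξ : EuclideanSpace ℝ (Fin 3) | (2 : ℝ) ^ (k - 3) < ‖ξ‖ ∧ ‖ξ‖ < (2 : ℝ) ^ (k + 3)} :=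
    measurableSet_annulus _ _
  have hSb : ∀ η ∈ {ξ : EuclideanSpace ℝ (Fin 3) | (2 : ℝ) ^ (k - 3) < ‖ξ‖ ∧ ‖ξ‖ < (2 : ℝ) ^ (k + 3)},
      ‖η‖ < (2 : ℝ) ^ (k + (3 : ℕ)) := fun η hη => by exact_mod_cast hη.2
  have hm := enorm_eulerForm_pieces_le H hF hG j k (memLp_top_annularCutoff k) (norm_annularCutoff_le k)
    (fun ξ₁ h₁ ξ₂ h₂ => annularCutoff_eq_one hjk h₁ h₂) hS (fun η hη => annularCutoff_eq_zero hη)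
    (setLIntegral_sq_lt_top H hSb hS)
  have hw := localized_product_rpow_le G H k 3 hS hSb
  refine hm.trans ?_
  rw [mul_assoc, mul_assoc (ENNReal.ofReal (72 * π) * 2 ^ 40 * _), show (2 : ℝ≥0∞) ^ 40 = 2 ^ (10 * (3 + 1)) by
    norm_num]
  calc ENNReal.ofReal (72 * π) *
        eLpNormDistrib ∞ (lpBlock j ((F : L2C) : 𝓢'(EuclideanSpace ℝ (Fin 3), EuclideanSpace ℂ (Fin 3)))) *
        ((∫⁻ ξ in {ξ : EuclideanSpace ℝ (Fin 3) | (2 : ℝ) ^ (k - 1) < ‖ξ‖ ∧ ‖ξ‖ < (2 : ℝ) ^ (k + 1)},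
          ‖fourierFn G ξ‖ₑ ^ 2) ^ (1 / 2 : ℝ) *
        (∫⁻ η in {ξ : EuclideanSpace ℝ (Fin 3) | (2 : ℝ) ^ (k - 3) < ‖ξ‖ ∧ ‖ξ‖ < (2 : ℝ) ^ (k + 3)},
          ‖η‖ₑ ^ 2 * ‖fourierFn H η‖ₑ ^ 2) ^ (1 / 2 : ℝ))
      ≤ ENNReal.ofReal (72 * π) *
        eLpNormDistrib ∞ (lpBlock j ((F : L2C) : 𝓢'(EuclideanSpace ℝ (Fin 3), EuclideanSpace ℂ (Fin 3)))) *
        ((2 : ℝ≥0∞) ^ (10 * (3 + 1)) *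
        (∫⁻ ξ in {ξ : EuclideanSpace ℝ (Fin 3) | (2 : ℝ) ^ (k - 1) < ‖ξ‖ ∧ ‖ξ‖ < (2 : ℝ) ^ (k + 1)},
          ENNReal.ofReal ((1 + ‖ξ‖ ^ 2) ^ (10 : ℝ)) * ‖fourierFn G ξ‖ₑ ^ 2) ^ (1 / 2 : ℝ) *
        (∫⁻ η in {ξ : EuclideanSpace ℝ (Fin 3) | (2 : ℝ) ^ (k - 3) < ‖ξ‖ ∧ ‖ξ‖ < (2 : ℝ) ^ (k + 3)},
          ENNReal.ofReal ((1 + ‖η‖ ^ 2) ^ (-9 : ℝ)) * ‖fourierFn H η‖ₑ ^ 2) ^ (1 / 2 : ℝ)) :=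
        mul_le_mul' le_rfl hw
    _ = _ := by ring

/-- **The diagonal region `|j - k| ≤ 2`**:
`|⟨B(P_jF, P_kG), H⟩| ≤ 72π · 2⁸⁰ ‖Δ̇_jF‖_{L^∞} ‖G‖_{H¹⁰} ‖H‖_{H⁻⁹}`. -/
theorem enorm_eulerForm_pieces_le_diag {F G : L2C} (H : L2C) (hF : IsFourierDivFree F)
    (hG : IsFourierDivFree G) {j k : ℤ} (hjk : j ≤ k + 2) (hkj : k ≤ j + 2) :
    ‖eulerForm (fourierMultiplier ((memLp_top_dyadicSymbol (E := EuclideanSpace ℝ (Fin 3)) j).toLp _) F)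
        (fourierMultiplier ((memLp_top_dyadicSymbol (E := EuclideanSpace ℝ (Fin 3)) k).toLp _) G) H‖ₑ ≤
      ENNReal.ofReal (72 * π) * 2 ^ 80 *
        eLpNormDistrib ∞ (lpBlock j ((F : L2C) : 𝓢'(EuclideanSpace ℝ (Fin 3), EuclideanSpace ℂ (Fin 3)))) *
        eFourierSobolevNorm 10 G * eFourierSobolevNorm (-9) H := by
  have hS : MeasurableSet {η : EuclideanSpace ℝ (Fin 3) | ‖η‖ < (2 : ℝ) ^ (j + 5)} :=
    measurableSet_lt measurable_norm measurable_const
  have hSb : ∀ η ∈ {η : EuclideanSpace ℝ (Fin 3) | ‖η‖ < (2 : ℝ) ^ (j + 5)}, ‖η‖ < (2 : ℝ) ^ (k + (7 : ℕ)) :=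
    fun η hη => lt_of_lt_of_le hη (zpow_le_zpow_right₀ one_le_two (by push_cast; omega))
  have hψS : ∀ η ∉ {η : EuclideanSpace ℝ (Fin 3) | ‖η‖ < (2 : ℝ) ^ (j + 5)}, lowFreqSymbol (j + 4) η = 0 :=
    fun η hη => lowFreqSymbol_eq_zero_of_le_norm (by
      rw [show j + 4 + 1 = j + 5 by ring]; exact not_lt.1 hη)
  have hm := enorm_eulerForm_pieces_le H hF hG j k (memLp_top_lowFreqSymbol (j + 4))
    (fun η => (norm_lowFreqSymbol_le_one _ η).trans one_le_two)
    (fun ξ₁ h₁ ξ₂ h₂ => lowCutoff_eq_one hkj h₁ h₂) hS hψS (setLIntegral_sq_lt_top H hSb hS)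
  have hw := localized_product_rpow_le G H k 7 hS hSb
  have hG10 : (∫⁻ ξ in {ξ : EuclideanSpace ℝ (Fin 3) | (2 : ℝ) ^ (k - 1) < ‖ξ‖ ∧ ‖ξ‖ < (2 : ℝ) ^ (k + 1)},
      ENNReal.ofReal ((1 + ‖ξ‖ ^ 2) ^ (10 : ℝ)) * ‖fourierFn G ξ‖ₑ ^ 2) ^ (1 / 2 : ℝ) ≤
      eFourierSobolevNorm 10 G := by
    rw [eFourierSobolevNorm_eq]
    exact ENNReal.rpow_le_rpow (setLIntegral_le_lintegral _ _) (by norm_num)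
  have hH9 : (∫⁻ η in {η : EuclideanSpace ℝ (Fin 3) | ‖η‖ < (2 : ℝ) ^ (j + 5)},
      ENNReal.ofReal ((1 + ‖η‖ ^ 2) ^ (-9 : ℝ)) * ‖fourierFn H η‖ₑ ^ 2) ^ (1 / 2 : ℝ) ≤
      eFourierSobolevNorm (-9) H := by
    rw [eFourierSobolevNorm_eq]
    exact ENNReal.rpow_le_rpow (setLIntegral_le_lintegral _ _) (by norm_num)
  refine hm.trans ?_
  rw [show (2 : ℝ≥0∞) ^ 80 = 2 ^ (10 * (7 + 1)) by norm_num]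
  calc ENNReal.ofReal (72 * π) *
        eLpNormDistrib ∞ (lpBlock j ((F : L2C) : 𝓢'(EuclideanSpace ℝ (Fin 3), EuclideanSpace ℂ (Fin 3)))) *
        (∫⁻ ξ in {ξ : EuclideanSpace ℝ (Fin 3) | (2 : ℝ) ^ (k - 1) < ‖ξ‖ ∧ ‖ξ‖ < (2 : ℝ) ^ (k + 1)},
          ‖fourierFn G ξ‖ₑ ^ 2) ^ (1 / 2 : ℝ) *
        (∫⁻ η in {η : EuclideanSpace ℝ (Fin 3) | ‖η‖ < (2 : ℝ) ^ (j + 5)},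
          ‖η‖ₑ ^ 2 * ‖fourierFn H η‖ₑ ^ 2) ^ (1 / 2 : ℝ)
      = ENNReal.ofReal (72 * π) *
        eLpNormDistrib ∞ (lpBlock j ((F : L2C) : 𝓢'(EuclideanSpace ℝ (Fin 3), EuclideanSpace ℂ (Fin 3)))) *
        ((∫⁻ ξ in {ξ : EuclideanSpace ℝ (Fin 3) | (2 : ℝ) ^ (k - 1) < ‖ξ‖ ∧ ‖ξ‖ < (2 : ℝ) ^ (k + 1)},
          ‖fourierFn G ξ‖ₑ ^ 2) ^ (1 / 2 : ℝ) *
        (∫⁻ η in {η : EuclideanSpace ℝ (Fin 3) | ‖η‖ < (2 : ℝ) ^ (j + 5)},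
          ‖η‖ₑ ^ 2 * ‖fourierFn H η‖ₑ ^ 2) ^ (1 / 2 : ℝ)) := by ring
    _ ≤ ENNReal.ofReal (72 * π) *
        eLpNormDistrib ∞ (lpBlock j ((F : L2C) : 𝓢'(EuclideanSpace ℝ (Fin 3), EuclideanSpace ℂ (Fin 3)))) *
        ((2 : ℝ≥0∞) ^ (10 * (7 + 1)) * eFourierSobolevNorm 10 G * eFourierSobolevNorm (-9) H) := by
        refine mul_le_mul' le_rfl (hw.trans ?_)
        rw [mul_assoc, mul_assoc]
        exact mul_le_mul' le_rfl (mul_le_mul' hG10 hH9)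
    _ = _ := by ring

end Summit.NavierStokesRegularity.NavierStokesRegularity.Theorems.PerpetualPumpThesis.FB

namespace Summit.NavierStokesRegularity.NavierStokesRegularity.Theorems.PerpetualPumpThesis

open MeasureTheory
open Literature.Analysis.FluidPDE Literature.Analysis.FluidPDE.Tao2016
open Literature.Analysis.FunctionSpaces

/-- **Part Regions of stub `tameDuhamelBound` (registered sub-goal `stub_FB_Regions`)**: the diagonal
region of Bony's bookkeeping for Tao's Euler form — for `|j - k| ≤ 2` the pair of dyadic pieces
`P_jF = φ_j(D)F`, `P_kG = φ_k(D)G` obeys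
`|⟨B(P_jF, P_kG), H⟩| ≤ 72π · 2⁸⁰ ‖Δ̇_jF‖_{L^∞} ‖G‖_{H¹⁰} ‖H‖_{H⁻⁹}`. -/
theorem stub_FB_Regions : ∀ (F G H : L2C), IsFourierDivFree F → IsFourierDivFree G → ∀ (j k : ℤ), j ≤ k + 2 → k ≤ j + 2 → ‖eulerForm (fourierMultiplier ((memLp_top_dyadicSymbol (E := EuclideanSpace ℝ (Fin 3)) j).toLp (dyadicSymbol j)) F) (fourierMultiplier ((memLp_top_dyadicSymbol (E := EuclideanSpace ℝ (Fin 3)) k).toLp (dyadicSymbol k)) G) H‖ₑ ≤ ENNReal.ofReal (72 * Real.pi) * 2 ^ 80 * eLpNormDistrib ⊤ (lpBlock j ((F : L2C) : 𝓢'(EuclideanSpace ℝ (Fin 3), EuclideanSpace ℂ (Fin 3)))) * eFourierSobolevNorm 10 G * eFourierSobolevNorm (-9) H :=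
  fun _ _ H hF hG _ _ hjk hkj => FB.enorm_eulerForm_pieces_le_diag H hF hG hjk hkj

end Summit.NavierStokesRegularity.NavierStokesRegularity.Theorems.PerpetualPumpThesis
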